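import Mathlib.LinearAlgebra.Matrix.Determinant.Basic
import Mathlib.Analysis.SpecialFunctions.Log.Summable
import Mathlib.Analysis.SpecialFunctions.Pow.Real
import Mathlib.Analysis.Calculus.IteratedDeriv.Defs
import Mathlib.Analysis.Complex.Basic
import HarnessLib

/-!
# Pólya frequency sequences and the Aissen–Schoenberg–Whitney–Edrei representation

Trunk T-ANALYSIS (Literature/Analysis/TotalPositivity); cite item `wi-03707` (route
RiemannHypothesis/TotalPositivity, statements `tp_assembly` / `tp_converse`).

* `IsPolyaFrequencySeq a` — a one-sided real sequence `(a_n)_{n ≥ 0}` (extended by `a_n = 0` for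
  `n < 0`) is a PÓLYA FREQUENCY (PF, totally positive) sequence: every minor of the Toeplitz
  matrix `(a_{i-j})_{i,j ≥ 0}` is `≥ 0` (Karlin 1968, Ch. 8, §1; Aissen–Schoenberg–Whitney 1952,
  §1). Minors are indexed by strictly increasing row/column selections `r, c : Fin m → ℕ`.
* `HasASWERepresentation a` — the generating function `Σ a_n wⁿ` converges near `w = 0` to
  `C · e^{γw} · ∏ᵢ(1 + αᵢ w) / ∏ᵢ(1 - βᵢ w)` with `C > 0`, `γ ≥ 0`, `αᵢ, βᵢ ≥ 0`,
  `Σ(αᵢ + βᵢ) < ∞` (products as Mathlib `tprod`, convergent by `Σ αᵢ, Σ βᵢ < ∞`).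
* Named facts (nothing asserted): `aswe_edrei` — for `a₀ > 0`, PF ⇔ ASWE representation
  (Aissen–Schoenberg–Whitney 1952 + Edrei 1952 = Karlin 1968, Ch. 8, Thm. 5.3); and the corollary
  the route needs, `pf_taylor_iff_zeros_of_order_lt_one` — for an ENTIRE `F` of order `< 1` with
  real Taylor coefficients and `F(0) > 0`, `(F⁽ⁿ⁾(0)/n!)` is PF iff all zeros of `F` are real and
  `≤ 0` (⇐: Hadamard genus `0`, `F = F(0)∏(1 + αᵢ z)`, and finite products/limits of the PF
  sequences `(1, αᵢ, 0, …)`; ⇒: by ASWE the g.f. is `C e^{γw}∏(1+αᵢw)/∏(1-βᵢw)` near `0`,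
  entireness kills the `βᵢ` (no cancellation: the zeros `-1/αᵢ` are negative), identity theorem).

## References

* M. Aissen, I. J. Schoenberg, A. M. Whitney, *On the generating functions of totally positive
  sequences I*, J. Analyse Math. 2 (1952) 93–103.
* A. Edrei, *On the generating functions of totally positive sequences II*, ibid. 104–109.
* S. Karlin, *Total Positivity I*, Stanford UP 1968, Ch. 8, §1 (PF sequences), Thm. 5.3
  (the representation theorem).
-/

noncomputable section

open scoped Topology
open Filter

namespace Literature.Analysis.TotalPositivity

/-! ### Pólya frequency sequences -/

/-- The two-sided extension of a one-sided sequence: `a_n = 0` for `n < 0`.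
[Karlin 1968, Ch. 8, §1] [folklore] -/
def seqZ (a : ℕ → ℝ) (n : ℤ) : ℝ :=
  if 0 ≤ n then a n.toNat else 0

/-- The minor of the Toeplitz matrix `(a_{i-j})_{i,j ≥ 0}` with rows `r` and columns `c`.
[Karlin 1968, Ch. 8, §1; Aissen–Schoenberg–Whitney 1952, §1] [cite: Karlin1968, Ch. 8 §1] -/
def toeplitzMinor (a : ℕ → ℝ) {m : ℕ} (r c : Fin m → ℕ) : ℝ :=
  (Matrix.of fun i j => seqZ a ((r i : ℤ) - c j)).det

/-- **Pólya frequency (totally positive) sequence**: all minors of the Toeplitz matrix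
`(a_{i-j})_{i,j ≥ 0}` (`a_n = 0` for `n < 0`) are non-negative. [Karlin 1968, Ch. 8, §1
(PF_∞ sequences); Aissen–Schoenberg–Whitney 1952, §1] [cite: Karlin1968, Ch. 8 §1] -/
def IsPolyaFrequencySeq (a : ℕ → ℝ) : Prop :=
  ∀ (m : ℕ) (r c : Fin m → ℕ), StrictMono r → StrictMono c → 0 ≤ toeplitzMinor a r c

/-- **The Aissen–Schoenberg–Whitney–Edrei form of the generating function**: near `w = 0`,
`Σₙ aₙ wⁿ = C · e^{γw} · ∏ᵢ (1 + αᵢ w) / ∏ᵢ (1 - βᵢ w)` with `C > 0`, `γ ≥ 0`, `αᵢ, βᵢ ≥ 0` and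
`Σ αᵢ < ∞`, `Σ βᵢ < ∞` (finitely many non-zero `αᵢ, βᵢ` allowed: pad with zeros).
[Karlin 1968, Ch. 8, Thm. 5.3; Aissen–Schoenberg–Whitney 1952; Edrei 1952] [cite: Karlin1968, Ch. 8 Thm. 5.3] -/
def HasASWERepresentation (a : ℕ → ℝ) : Prop :=
  ∃ (C γ : ℝ) (α β : ℕ → ℝ), 0 < C ∧ 0 ≤ γ ∧ (∀ i, 0 ≤ α i) ∧ (∀ i, 0 ≤ β i) ∧
    Summable α ∧ Summable β ∧
      ∃ ρ : ℝ, 0 < ρ ∧ ∀ w : ℝ, |w| < ρ →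
        HasSum (fun n : ℕ => a n * w ^ n)
          (C * Real.exp (γ * w) * (∏' i, (1 + α i * w)) / ∏' i, (1 - β i * w))

/-! ### Named facts (nothing asserted) -/

/-- NAMED FACT (**Aissen–Schoenberg–Whitney 1952 / Edrei 1952; Karlin 1968, Ch. 8, Thm. 5.3**):
a real sequence `(aₙ)_{n ≥ 0}` with `a₀ > 0` is a Pólya frequency sequence iff its generating
function has the ASWE form near `0`. Users take `(h : aswe_edrei)`.
[Karlin 1968, Ch. 8, Thm. 5.3; Aissen–Schoenberg–Whitney 1952 (the form up to an entire factor);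
Edrei 1952 (the factor is `e^{γw}`)] [cite: Karlin1968, Ch. 8 Thm. 5.3] -/
def aswe_edrei : Prop :=
  ∀ a : ℕ → ℝ, 0 < a 0 → (IsPolyaFrequencySeq a ↔ HasASWERepresentation a)

/-- Entire of ORDER `< 1`, quantitatively: `‖F z‖ ≤ C exp(‖z‖^ρ)` for some `ρ < 1`.
[Karlin 1968, Ch. 8, §5 (genus-zero entire functions); folklore (Hadamard)] [folklore] -/
def IsEntireOfOrderLtOne (F : ℂ → ℂ) : Prop :=
  Differentiable ℂ F ∧ ∃ ρ C : ℝ, ρ < 1 ∧ ∀ z : ℂ, ‖F z‖ ≤ C * Real.exp (‖z‖ ^ ρ)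

/-- NAMED FACT (corollary of ASWE for entire functions of genus `0`; **Karlin 1968, Ch. 8,
Thm. 5.3** with Hadamard's factorisation): for an entire `F` of order `< 1` with real Taylor
coefficients at `0` and `F(0) > 0`, the Taylor sequence `(F⁽ⁿ⁾(0)/n!)ₙ` is a Pólya frequency
sequence iff every zero of `F` is real and `≤ 0`. Users take
`(h : pf_taylor_iff_zeros_of_order_lt_one)`. [Karlin 1968, Ch. 8, Thm. 5.3 (entire case:
`βᵢ = 0`, zeros `-1/αᵢ`); Aissen–Schoenberg–Whitney 1952] [cite: Karlin1968, Ch. 8 Thm. 5.3] -/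
def pf_taylor_iff_zeros_of_order_lt_one : Prop :=
  ∀ F : ℂ → ℂ, IsEntireOfOrderLtOne F → (∀ n : ℕ, (iteratedDeriv n F 0).im = 0) → 0 < (F 0).re →
    (IsPolyaFrequencySeq (fun n => (iteratedDeriv n F 0).re / n.factorial) ↔
      ∀ z : ℂ, F z = 0 → z.im = 0 ∧ z.re ≤ 0)

/-! ### API -/

/-- `seqZ` on non-negative integers. [folklore] -/
@[simp] theorem seqZ_natCast (a : ℕ → ℝ) (n : ℕ) : seqZ a n = a n := by
  simp [seqZ]

/-- `seqZ` vanishes on negative integers. [folklore] -/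
theorem seqZ_of_neg (a : ℕ → ℝ) {n : ℤ} (hn : n < 0) : seqZ a n = 0 := by
  simp [seqZ, not_le.2 hn]

/-- The `1 × 1` minors are the terms: a PF sequence is non-negative. [Karlin 1968, Ch. 8, §1] [folklore] -/
theorem IsPolyaFrequencySeq.nonneg {a : ℕ → ℝ} (h : IsPolyaFrequencySeq a) (n : ℕ) : 0 ≤ a n := by
  have := h 1 (fun _ => n) (fun _ => 0) (fun i j hij => absurd hij (by simp [Fin.eq_zero i, Fin.eq_zero j]))
    (fun i j hij => absurd hij (by simp [Fin.eq_zero i, Fin.eq_zero j]))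
  simpa [toeplitzMinor, Matrix.det_unique] using this

/-- The `2 × 2` minors with consecutive indices: a PF sequence is log-concave,
`a_{n+1}² ≥ a_n a_{n+2}` (rows `n+1 < n+2`, columns `0 < 1`). [Karlin 1968, Ch. 8, §1 (PF₂)] [folklore] -/
theorem IsPolyaFrequencySeq.logConcave {a : ℕ → ℝ} (h : IsPolyaFrequencySeq a) (n : ℕ) :
    a n * a (n + 2) ≤ a (n + 1) * a (n + 1) := by
  have hr : StrictMono ![n + 1, n + 2] := by
    refine Fin.strictMono_iff_lt_succ.2 fun i => ?_
    fin_cases i; simp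
  have hc : StrictMono (![0, 1] : Fin 2 → ℕ) := by
    refine Fin.strictMono_iff_lt_succ.2 fun i => ?_
    fin_cases i; simp
  have := h 2 ![n + 1, n + 2] ![0, 1] hr hc
  rw [toeplitzMinor, Matrix.det_fin_two] at this
  simp only [Matrix.of_apply, Matrix.cons_val_zero, Matrix.cons_val_one] at this
  have e1 : ((n + 1 : ℕ) : ℤ) - ((0 : ℕ) : ℤ) = ((n + 1 : ℕ) : ℤ) := by simp
  have e2 : ((n + 2 : ℕ) : ℤ) - ((1 : ℕ) : ℤ) = ((n + 1 : ℕ) : ℤ) := by push_cast; ring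
  have e3 : ((n + 1 : ℕ) : ℤ) - ((1 : ℕ) : ℤ) = ((n : ℕ) : ℤ) := by push_cast; ring
  have e4 : ((n + 2 : ℕ) : ℤ) - ((0 : ℕ) : ℤ) = ((n + 2 : ℕ) : ℤ) := by simp
  simp only [e1, e2, e3, e4, seqZ_natCast] at this
  linarith

/-- The constant sequence `(1, 0, 0, …)` has the ASWE representation with `C = 1`, `γ = 0`,
`α = β = 0` (non-vacuity of `HasASWERepresentation`). [folklore] -/
theorem hasASWERepresentation_one_zero :
    HasASWERepresentation (fun n => if n = 0 then 1 else 0) := by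
  refine ⟨1, 0, 0, 0, one_pos, le_rfl, fun _ => le_rfl, fun _ => le_rfl, summable_zero,
    summable_zero, 1, one_pos, fun w _ => ?_⟩
  have : (1 : ℝ) * Real.exp (0 * w) * (∏' _ : ℕ, (1 + (0 : ℕ → ℝ) 0 * w)) /
      ∏' _ : ℕ, (1 - (0 : ℕ → ℝ) 0 * w) = 1 := by simp
  simp only [Pi.zero_apply, zero_mul, add_zero, sub_zero, tprod_one, Real.exp_zero, mul_one,
    div_one]
  convert hasSum_ite_eq 0 (1 : ℝ) using 1
  funext n
  split_ifs with h <;> simp [h]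

end Literature.Analysis.TotalPositivity
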